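import Summits.CriticalPhenomena.PercolationContinuityZ3.Theorems.PercNearOneGluingNoHeavyLowerTailSahiCTCRtThreeWindowThreeSum
import Summits.CriticalPhenomena.PercolationContinuityZ3.Theorems.PercNearOneGluingNoHeavyLowerTailSahiCTCRtThreeWindowThreePoly
import Summits.CriticalPhenomena.PercolationContinuityZ3.Theorems.PercNearOneGluingNoHeavyLowerTailSahiCTCRtThreeWindowFourCheck
import HarnessLib

/-!
# `NoHeavyLowerTail` (crux stmt-CriticalPhenomena-4575), P3 lane: the THREE-POINT WINDOW CERTIFICATE of ROW 1 — the finite check and its soundness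

Support file (seat `prim-l12-p3`, gen 51; `--supports stmt-CriticalPhenomena-4575`; `--computational`: ONE `native_decide`, the enumeration `checkAll₃ = true`
over the `123²` admissible trace pairs on `Fin 3`, inside `checkPair₃_of_mem`).  Memo `run/shared/lean/prim/prim-l12/FROM-prim-l12-p3-g51-ROW0-ALL-K-LEAN.md` §5.
Row-1 twin of `…RtThreeWindowFourCheck`:
* coding on `Fin 3` (`testBit_encS₃(_val)`, `encS₃_injective`, `encS₃_insert`, `testBit_encF₃`, `bit₃_encF₃_encS₃`), soundness of the coded moments
  (`momJc₃_encF₃`; `ιq_bySize_lt`, `ιq_below`, `ιq_inter`, `ιq_sdiff_union`, `momWc_encF₃`);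
* unpacking (`checkPair₃_of_mem`, `nonneg_of_checkPair₃`, `lin₃_eq`, `direct₃_eq`, `mem_sides₃`);
* **`loc_nonneg_fin3`** : for `k ≥ 3` and admissible trace data the local quantity of `coeff_rowOne_nonneg_of_local` on `Fin 3` is `≥ 0`
  (`k ≥ 6`: Taylor coefficients at `5` and `Dfac₅ > 0`; `k = 3, 4, 5`: the direct values).
`set_option maxRecDepth` is raised on three declarations: membership in `sides₃` unfolds a large decidable predicate.  No new definitions; nothing is
asserted about the crux.
-/


namespace Summit.CriticalPhenomena.PercolationContinuityZ3.Theorems.SahiCTCForms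

open Finset MvPolynomial SahiCTCGenFun

/-! ## Part CHECK (row 1): coding lemmas, soundness of the coded moments, the finite check, the local inequality on `Fin 3` -/

namespace RtThreeFin3

/-! ### Coding lemmas on `Fin 3` -/

/-- Bits of `encS₃`. [this work] -/
theorem testBit_encS₃ (S : Finset (Fin 3)) (i : ℕ) : (encS₃ S).testBit i ↔ i ∈ S.map Fin.valEmbedding := by
  have h : encS₃ S = ∑ t ∈ S.map Fin.valEmbedding, 2 ^ t := by unfold encS₃; rw [sum_map]; rfl
  rw [h, ← Nat.mem_bitIndices, ← List.mem_toFinset, Finset.toFinset_bitIndices_sum_two_pow]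

/-- Bits of `encS₃` at the value of `i : Fin 3`. [this work] -/
theorem testBit_encS₃_val (S : Finset (Fin 3)) (i : Fin 3) : (encS₃ S).testBit (i : ℕ) ↔ i ∈ S := by
  rw [testBit_encS₃, mem_map]
  exact ⟨fun ⟨a, ha, hai⟩ => (Fin.ext hai : a = i) ▸ ha, fun hi => ⟨i, hi, rfl⟩⟩

/-- `encS₃` is injective. [this work] -/
theorem encS₃_injective : Function.Injective encS₃ := by
  intro S T h
  ext i
  rw [← testBit_encS₃_val, ← testBit_encS₃_val, h]

/-- `encS₃ (insert u A) = 2^u + encS₃ A` for `u ∉ A`. [this work] -/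
theorem encS₃_insert {A : Finset (Fin 3)} {u : Fin 3} (h : u ∉ A) : encS₃ (insert u A) = 2 ^ (u : ℕ) + encS₃ A := by
  unfold encS₃; rw [sum_insert h]

/-- Bits of `encF₃`. [this work] -/
theorem testBit_encF₃ (F : Finset (Finset (Fin 3))) (c : ℕ) : (encF₃ F).testBit c ↔ ∃ S ∈ F, encS₃ S = c := by
  unfold encF₃
  have h : ∑ S ∈ F, 2 ^ encS₃ S = ∑ t ∈ F.image encS₃, 2 ^ t := (sum_image fun x _ y _ h => encS₃_injective h).symm
  rw [h, ← Nat.mem_bitIndices, ← List.mem_toFinset, Finset.toFinset_bitIndices_sum_two_pow, mem_image]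

/-- The bit of a family code at a set code is the membership indicator. [this work] -/
theorem bit₃_encF₃_encS₃ (F : Finset (Finset (Fin 3))) (S : Finset (Fin 3)) : bit₃ (encF₃ F) (encS₃ S) = ιq F S := by
  unfold bit₃ ιq
  have h : (encF₃ F).testBit (encS₃ S) = true ↔ S ∈ F := by
    rw [testBit_encF₃]
    exact ⟨fun ⟨T, hT, hTS⟩ => encS₃_injective hTS ▸ hT, fun hS => ⟨S, hS, rfl⟩⟩
  by_cases hS : S ∈ F
  · rw [if_pos (h.2 hS), if_pos hS]
  · rw [if_neg (fun h' => hS (h.1 h')), if_neg hS]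

/-! ### Soundness of the coded moments -/

/-- The coded `J`-moment at the codes of `(𝒜, ℬ)` is the `J`-moment. [this work] -/
theorem momJc₃_encF₃ (t s : ℕ) (A B : Finset (Finset (Fin 3))) : momJc₃ (atomsK₃ t s) (encF₃ A) (encF₃ B) = momJ₃ t s A B := by
  unfold momJc₃ atomsK₃ momJ₃
  rw [sum_image]
  · refine sum_congr rfl fun x hx => ?_
    obtain ⟨_, huA, huB⟩ := mem_filter.1 (mem_filter.1 hx).1
    rw [← encS₃_insert huA, ← encS₃_insert huB, bit₃_encF₃_encS₃, bit₃_encF₃_encS₃, bit₃_encF₃_encS₃, bit₃_encF₃_encS₃]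
  · intro x _ y _ h
    simp only [Prod.mk.injEq] at h
    exact Prod.ext (encS₃_injective h.1) (Prod.ext (Fin.ext h.2.1) (encS₃_injective h.2.2))

section Indicators
variable (K L L' : Finset (Finset (Fin 3))) (P : Finset (Fin 3))

/-- `[P ∈ Θ_j] = [#P < j]` on `Fin 3`. [this work] -/
theorem ιq_bySize_lt (j : ℕ) : ιq (bySize (· < j) : Finset (Finset (Fin 3))) P = if #P < j then 1 else 0 := by
  unfold ιq bySize; simp only [mem_filter, mem_powerset, subset_univ, true_and]

/-- `[P ∈ K_{<j}] = [#P < j]·[P ∈ K]`. [this work] -/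
theorem ιq_below (j : ℕ) : ιq (below j K) P = (if #P < j then 1 else 0) * ιq K P := by
  unfold ιq below; simp only [mem_filter]
  by_cases h1 : P ∈ K <;> by_cases h2 : #P < j <;> simp [h1, h2]

/-- `[P ∈ K ∩ L] = [P ∈ K]·[P ∈ L]`. [this work] -/
theorem ιq_inter : ιq (K ∩ L) P = ιq K P * ιq L P := by
  unfold ιq; simp only [mem_inter]
  by_cases h1 : P ∈ K <;> by_cases h2 : P ∈ L <;> simp [h1, h2]

/-- `[P ∈ K ∖ (L ∪ L')] = [P ∈ K]·(1 − [P ∈ L])·(1 − [P ∈ L'])`. [this work] -/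
theorem ιq_sdiff_union : ιq (K \ (L ∪ L')) P = ιq K P * (1 - ιq L P) * (1 - ιq L' P) := by
  unfold ιq; simp only [mem_sdiff, mem_union, not_or]
  by_cases h1 : P ∈ K <;> by_cases h2 : P ∈ L <;> by_cases h3 : P ∈ L' <;> simp [h1, h2, h3]

end Indicators

/-- The coded window moment at the codes of the trace data is the window moment. [this work] -/
theorem momWc_encF₃ (m : ℕ) (X0 X1 Z0 Z1 : Finset (Finset (Fin 3))) :
    momWc (pairsK₃ m) (encF₃ X0) (encF₃ X1) (encF₃ Z0) (encF₃ Z1) = momW m X0 X1 Z0 Z1 := by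
  unfold momWc pairsK₃ momW
  rw [sum_image]
  · refine sum_congr rfl fun x _ => ?_
    simp only [bit₃_encF₃_encS₃, ιq_bySize_lt, ιq_below, ιq_inter, ιq_sdiff_union]
    ring
  · intro x _ y _ h
    simp only [Prod.mk.injEq] at h
    exact Prod.ext (encS₃_injective h.1) (encS₃_injective h.2.2.1)

/-! ### The finite check and its unpacking -/

set_option maxRecDepth 16384 in
-- (membership in `sides₃` unfolds a large decidable predicate)
/-- **THE FINITE CHECK** `checkAll₃ = true` (`123²` admissible trace pairs; ONE `native_decide`, ≈ 30 s), unpacked for a pair of sides. [this work] -/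
theorem checkPair₃_of_mem {X0 X1 Z0 Z1 : Finset (Finset (Fin 3))} (hX : (X0, X1) ∈ sides₃) (hZ : (Z0, Z1) ∈ sides₃) :
    checkPair₃ (CL3l.map fun c => atomsK₃ c.1 c.2) ((List.range 4).map fun m => pairsK₃ m) (encF₃ X0) (encF₃ X1) (encF₃ Z0) (encF₃ Z1) = true := by
  have h : checkAll₃ = true := by native_decide
  unfold checkAll₃ at h
  dsimp only at h
  have h' := of_decide_eq_true h
  have hx : (encF₃ X0, encF₃ X1) ∈ sides₃.image (fun p => (encF₃ p.1, encF₃ p.2)) := mem_image.2 ⟨(X0, X1), hX, rfl⟩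
  have hz : (encF₃ Z0, encF₃ Z1) ∈ sides₃.image (fun p => (encF₃ p.1, encF₃ p.2)) := mem_image.2 ⟨(Z0, Z1), hZ, rfl⟩
  exact h' (encF₃ X0, encF₃ X1) hx (encF₃ Z0, encF₃ Z1) hz

/-- Unpacking `checkPair₃`: the eight Taylor forms and the three direct values are `≥ 0`. [this work] -/
theorem nonneg_of_checkPair₃ {tJ : List (Finset (ℕ × ℕ × ℕ))} {tP : List (Finset (ℕ × ℕ × ℕ × ℕ))} {x0 x1 z0 z1 : ℕ}
    (h : checkPair₃ tJ tP x0 x1 z0 z1 = true) :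
    (∀ i, i < 8 → 0 ≤ lin₃ i (tJ.map fun t => momJc₃ t x1 z1) (tJ.map fun t => momJc₃ t x0 z1 + momJc₃ t x1 z0) (tP.map fun t => momWc t x0 x1 z0 z1))
    ∧ (∀ k, k = 3 ∨ k = 4 ∨ k = 5 →
        0 ≤ direct₃ k (tJ.map fun t => momJc₃ t x1 z1) (tJ.map fun t => momJc₃ t x0 z1 + momJc₃ t x1 z0) (tP.map fun t => momWc t x0 x1 z0 z1)) := by
  unfold checkPair₃ at h
  simp only [Bool.and_eq_true, List.all_eq_true, List.mem_range, decide_eq_true_eq, List.mem_cons, List.not_mem_nil, or_false] at h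
  exact ⟨h.1, h.2⟩

/-- The Taylor form `lin₃ i` on the coded moment vectors as Finset sums. [this work] -/
theorem lin₃_eq (i x0 x1 z0 z1 : ℕ) :
    lin₃ i ((CL3l.map fun c => atomsK₃ c.1 c.2).map fun t => momJc₃ t x1 z1)
        ((CL3l.map fun c => atomsK₃ c.1 c.2).map fun t => momJc₃ t x0 z1 + momJc₃ t x1 z0)
        (((List.range 4).map fun m => pairsK₃ m).map fun t => momWc t x0 x1 z0 z1) =
      ∑ c ∈ CL3l.toFinset, ((SA c.1 c.2 i : ℤ) : ℚ) * momJc₃ (atomsK₃ c.1 c.2) x1 z1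
        + ∑ c ∈ CL3l.toFinset, ((SB c.1 c.2 i : ℤ) : ℚ) * (momJc₃ (atomsK₃ c.1 c.2) x0 z1 + momJc₃ (atomsK₃ c.1 c.2) x1 z0)
        + ∑ m ∈ range 4, ((SP3 m i : ℤ) : ℚ) * momWc (pairsK₃ m) x0 x1 z0 z1 := by
  unfold lin₃
  rw [List.map_map, List.map_map, List.map_map, RtThreeFin4.zipWith_map_self, RtThreeFin4.zipWith_map_self, RtThreeFin4.zipWith_map_self,
    ← List.sum_toFinset _ (by decide : CL3l.Nodup), ← List.sum_toFinset _ (by decide : CL3l.Nodup), ← List.sum_toFinset _ (List.nodup_range),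
    List.toFinset_range]
  rfl

/-- The direct form `direct₃ k` on the coded moment vectors as Finset sums. [this work] -/
theorem direct₃_eq (k x0 x1 z0 z1 : ℕ) :
    direct₃ k ((CL3l.map fun c => atomsK₃ c.1 c.2).map fun t => momJc₃ t x1 z1)
        ((CL3l.map fun c => atomsK₃ c.1 c.2).map fun t => momJc₃ t x0 z1 + momJc₃ t x1 z0)
        (((List.range 4).map fun m => pairsK₃ m).map fun t => momWc t x0 x1 z0 z1) =
      ∑ c ∈ CL3l.toFinset, WlocT 3 k c.1 c.2 * momJc₃ (atomsK₃ c.1 c.2) x1 z1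
        + ∑ c ∈ CL3l.toFinset, WlocT 2 k c.1 c.2 * (momJc₃ (atomsK₃ c.1 c.2) x0 z1 + momJc₃ (atomsK₃ c.1 c.2) x1 z0)
        + ∑ m ∈ range 4, (1 / ((((k - m).choose (3 - m)) : ℕ) : ℚ)) * momWc (pairsK₃ m) x0 x1 z0 z1 := by
  unfold direct₃
  rw [List.map_map, List.map_map, List.map_map, RtThreeFin4.zipWith_map_self, RtThreeFin4.zipWith_map_self, RtThreeFin4.zipWith_map_self,
    ← List.sum_toFinset _ (by decide : CL3l.Nodup), ← List.sum_toFinset _ (by decide : CL3l.Nodup), ← List.sum_toFinset _ (List.nodup_range),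
    List.toFinset_range]
  refine congrArg₂ (· + ·) rfl (sum_congr rfl fun m _ => ?_)
  simp only [Function.comp]
  ring

set_option maxRecDepth 16384 in
-- (membership in `sides₃` unfolds a large decidable predicate)
/-- A pair of families is an admissible side when both are up-closed, nested, and the smaller one has only members of size `≥ 2`. [this work] -/
theorem mem_sides₃ {A0 A1 : Finset (Finset (Fin 3))} (h0 : ∀ S ∈ A0, ∀ T : Finset (Fin 3), S ⊆ T → T ∈ A0)
    (h1 : ∀ S ∈ A1, ∀ T : Finset (Fin 3), S ⊆ T → T ∈ A1) (hsub : A0 ⊆ A1) (h2 : ∀ S ∈ A0, 2 ≤ #S) : (A0, A1) ∈ sides₃ := by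
  have hu0 : isUp₃ A0 = true := by
    unfold isUp₃; exact decide_eq_true fun S hS T _ hST => h0 S hS T hST
  have hu1 : isUp₃ A1 = true := by
    unfold isUp₃; exact decide_eq_true fun S hS T _ hST => h1 S hS T hST
  unfold sides₃
  rw [mem_filter]
  exact ⟨mem_product.2 ⟨mem_univ _, mem_univ _⟩, hu0, hu1, fun S hS => hsub hS, h2⟩

set_option maxRecDepth 16384 in
-- (membership in `sides₃` unfolds a large decidable predicate)
/-- **THE LOCAL INEQUALITY OF ROW 1 ON `Fin 3`** (the hypothesis of `…RtThreeRowOneWindow.coeff_rowOne_nonneg_of_local` transported to `Fin 3`): for `k ≥ 3` and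
admissible trace data `(X⁰ ⊆ X¹)`, `(Z⁰ ⊆ Z¹)`, the three local atom sums plus the seven localised pair sums are `≥ 0`. [this work] -/
theorem loc_nonneg_fin3 (k : ℕ) (hk : 3 ≤ k) (X0 X1 Z0 Z1 : Finset (Finset (Fin 3))) (hX : (X0, X1) ∈ sides₃) (hZ : (Z0, Z1) ∈ sides₃) :
    0 ≤ atomSum
        (fun a b c => (if 4 ≤ a + b + c then 0 else ∑ t ∈ range 3, (((k - a - b - c).choose t : ℕ) : ℚ) *
          (if b + c < k - t then ((((k - t : ℕ) : ℚ)) * ((((k - t - 1).choose (b + c) : ℕ) : ℚ)))⁻¹ else 0))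
          / (((k - (a + b + c)).choose (3 - (a + b + c)) : ℕ) : ℚ))
        (fun a b c => (0 : ℚ) / (((k - (a + b + c)).choose (3 - (a + b + c)) : ℕ) : ℚ)) (fun a b c => (0 : ℚ) / (((k - (a + b + c)).choose (3 - (a + b + c)) : ℕ) : ℚ)) (fun a b c => (0 : ℚ) / (((k - (a + b + c)).choose (3 - (a + b + c)) : ℕ) : ℚ)) (fun a b c => (0 : ℚ) / (((k - (a + b + c)).choose (3 - (a + b + c)) : ℕ) : ℚ)) X1 Z1 univ
      + atomSum
        (fun a b c => (if 4 ≤ a + b + c then 0 else ∑ t ∈ range 2, (((k - a - b - c).choose t : ℕ) : ℚ) *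
          (if b + c < k - t then ((((k - t : ℕ) : ℚ)) * ((((k - t - 1).choose (b + c) : ℕ) : ℚ)))⁻¹ else 0))
          / (((k - (a + b + c)).choose (3 - (a + b + c)) : ℕ) : ℚ))
        (fun a b c => (0 : ℚ) / (((k - (a + b + c)).choose (3 - (a + b + c)) : ℕ) : ℚ)) (fun a b c => (0 : ℚ) / (((k - (a + b + c)).choose (3 - (a + b + c)) : ℕ) : ℚ)) (fun a b c => (0 : ℚ) / (((k - (a + b + c)).choose (3 - (a + b + c)) : ℕ) : ℚ)) (fun a b c => (0 : ℚ) / (((k - (a + b + c)).choose (3 - (a + b + c)) : ℕ) : ℚ)) X0 Z1 univ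
      + atomSum
        (fun a b c => (if 4 ≤ a + b + c then 0 else ∑ t ∈ range 2, (((k - a - b - c).choose t : ℕ) : ℚ) *
          (if b + c < k - t then ((((k - t : ℕ) : ℚ)) * ((((k - t - 1).choose (b + c) : ℕ) : ℚ)))⁻¹ else 0))
          / (((k - (a + b + c)).choose (3 - (a + b + c)) : ℕ) : ℚ))
        (fun a b c => (0 : ℚ) / (((k - (a + b + c)).choose (3 - (a + b + c)) : ℕ) : ℚ)) (fun a b c => (0 : ℚ) / (((k - (a + b + c)).choose (3 - (a + b + c)) : ℕ) : ℚ)) (fun a b c => (0 : ℚ) / (((k - (a + b + c)).choose (3 - (a + b + c)) : ℕ) : ℚ)) (fun a b c => (0 : ℚ) / (((k - (a + b + c)).choose (3 - (a + b + c)) : ℕ) : ℚ)) X1 Z0 univ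
      + ((∑ P ∈ (univ : Finset (Fin 3)).powerset, ∑ P' ∈ (univ : Finset (Fin 3)).powerset,
          ιq (bySize (· < 2) : Finset (Finset (Fin 3))) P * ιq (below 3 ((X1 ∩ Z1) \ (X0 ∪ Z0))) P' * (if Disjoint P P' then 1 else 0) / (((k - #(P ∪ P')).choose (3 - #(P ∪ P')) : ℕ) : ℚ))
      - (∑ P ∈ (univ : Finset (Fin 3)).powerset, ∑ P' ∈ (univ : Finset (Fin 3)).powerset,
          ιq (bySize (· < 3) : Finset (Finset (Fin 3))) P * ιq (below 2 (X1 ∩ Z1)) P' * (if Disjoint P P' then 1 else 0) / (((k - #(P ∪ P')).choose (3 - #(P ∪ P')) : ℕ) : ℚ))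
      - (∑ P ∈ (univ : Finset (Fin 3)).powerset, ∑ P' ∈ (univ : Finset (Fin 3)).powerset,
          ιq (bySize (· < 2) : Finset (Finset (Fin 3))) P * ιq (below 3 (X0 ∩ Z0)) P' * (if Disjoint P P' then 1 else 0) / (((k - #(P ∪ P')).choose (3 - #(P ∪ P')) : ℕ) : ℚ))
      - (∑ P ∈ (univ : Finset (Fin 3)).powerset, ∑ P' ∈ (univ : Finset (Fin 3)).powerset,
          ιq (bySize (· < 2) : Finset (Finset (Fin 3))) P * ιq (below 2 (X1 ∩ Z1)) P' * (if Disjoint P P' then 1 else 0) / (((k - #(P ∪ P')).choose (3 - #(P ∪ P')) : ℕ) : ℚ))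
      + (∑ P ∈ (univ : Finset (Fin 3)).powerset, ∑ P' ∈ (univ : Finset (Fin 3)).powerset,
          ιq (below 2 X1) P * ιq (below 3 Z0) P' * (if Disjoint P P' then 1 else 0) / (((k - #(P ∪ P')).choose (3 - #(P ∪ P')) : ℕ) : ℚ))
      + (∑ P ∈ (univ : Finset (Fin 3)).powerset, ∑ P' ∈ (univ : Finset (Fin 3)).powerset,
          ιq (below 3 X0) P * ιq (below 2 Z1) P' * (if Disjoint P P' then 1 else 0) / (((k - #(P ∪ P')).choose (3 - #(P ∪ P')) : ℕ) : ℚ))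
      + (∑ P ∈ (univ : Finset (Fin 3)).powerset, ∑ P' ∈ (univ : Finset (Fin 3)).powerset,
          ιq (below 2 X1) P * ιq (below 2 Z1) P' * (if Disjoint P P' then 1 else 0) / (((k - #(P ∪ P')).choose (3 - #(P ∪ P')) : ℕ) : ℚ))) := by
  rw [atomSum_local₃_eq, atomSum_local₃_eq, atomSum_local₃_eq, pairs_local₃_eq]
  have hcomb : ∑ c ∈ CL3l.toFinset, WlocT 2 k c.1 c.2 * momJ₃ c.1 c.2 X0 Z1 + ∑ c ∈ CL3l.toFinset, WlocT 2 k c.1 c.2 * momJ₃ c.1 c.2 X1 Z0 =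
      ∑ c ∈ CL3l.toFinset, WlocT 2 k c.1 c.2 * (momJ₃ c.1 c.2 X0 Z1 + momJ₃ c.1 c.2 X1 Z0) := by
    rw [← sum_add_distrib]; exact sum_congr rfl fun c _ => by ring
  rw [add_assoc (∑ c ∈ CL3l.toFinset, WlocT 3 k c.1 c.2 * momJ₃ c.1 c.2 X1 Z1), hcomb]
  have hcheck := checkPair₃_of_mem hX hZ
  by_cases h6 : 6 ≤ k
  · obtain ⟨j, hj⟩ : ∃ j, k = j + 5 := ⟨k - 5, by omega⟩
    rw [hj]
    have hlin := (nonneg_of_checkPair₃ hcheck).1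
    have hD : 0 < Dfac₅ j := by
      unfold Dfac₅
      have : (1 : ℚ) ≤ j := by exact_mod_cast (show 1 ≤ j by omega)
      positivity
    refine (mul_nonneg_iff_of_pos_left hD).1 ?_
    rw [loc_poly₃ j (fun t s => momJ₃ t s X1 Z1) (fun t s => momJ₃ t s X0 Z1 + momJ₃ t s X1 Z0) (fun m => momW m X0 X1 Z0 Z1)]
    refine sum_nonneg fun i hi => mul_nonneg ?_ (by positivity)
    have h := hlin i (mem_range.1 hi)
    rw [lin₃_eq] at h
    simp only [momJc₃_encF₃, momWc_encF₃] at h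
    exact h
  · have h := (nonneg_of_checkPair₃ hcheck).2 k (by omega)
    rw [direct₃_eq] at h
    simp only [momJc₃_encF₃, momWc_encF₃] at h
    exact h

end RtThreeFin3

end Summit.CriticalPhenomena.PercolationContinuityZ3.Theorems.SahiCTCForms
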